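import Literature.Topology.FourManifolds.ThickenedHandlebodyFour
import Literature.Topology.FourManifolds.HandleCountNormalisation
import Literature.Topology.FourManifolds.SPC4HandlesLeaves
import Literature.Topology.FourManifolds.OneHandleStepExists
import Literature.Topology.FourManifolds.ClosedBallHandles
import HarnessLib

/-!
# Thickened planar domains with several minima: `{q(x, y) + z² + w² ≤ c} ⊂ ℝ⁴` with `m`
# `0`-handles and `s` `1`-handles, and the ball case

Topic `Literature/Topology/FourManifolds`; brick E1-M(b) of the constructive road (P1′), route M,
to `Literature.Topology.FourManifolds.Trisection.isConnectedSum_of_reducing_separating`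
(`ReducibleTrisectionSplitting.lean`, § Status).  `ThickenedHandlebodyFour.lean` treats planar
Morse functions `q` with ONE minimum and `g` saddles below the level `c`
(`IsHoledDiscMorseFunction g q c`) and proves that `{q + z² + w² ≤ c}` is a compact connected
orientable `4`-manifold with boundary with `HasHandleDecomposition 3 _ (handleCount 1 g)`.  The
core `Z₀` of a cut `1`-handlebody on road (P1′) is such a thickening for a planar function with
**several** minima (`k + 1`) and `k` saddles below the level; this file is the corresponding
generalisation, with the normalisation of the counts on a connected body and the ball case:

* `IsPlanarCoreMorseFunction m s q c` (§1): `q` Morse and coercive on `ℝ²`, finitely many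
  critical points, no critical value `c`, `m` critical points of index `0` and `s` of index `1`
  below `c`, all critical points of index `2` above `c`
  (`IsHoledDiscMorseFunction.isPlanarCoreMorseFunction`: the one-minimum case is the case
  `m = 1`);
* §2 (as in `ThickenedHandlebodyFour.lean` §4, whose one-minimum lemmas are repeated here as
  private auxiliaries): `G = q + z² + w²` is Morse with regular level `c`,
  `FourThickening := RegularSublevel _` is compact and orientable, and
  `hasHandleDecomposition_fourThickening : HasHandleDecomposition 3 _ (handleCount m s)`
  (public: `FourThickening`, `ncard_criticalSetOfIndex_inter(₄)`, the `CompactSpace` instance,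
  `apply_incl_ne_of_isMCriticalPt`);
* §3: if moreover the thickening is **connected** and `m = r + 1`, `s = s' + r`, then
  `HasHandleDecomposition 3 _ (handleCount 1 s')` (`HandleCountNormalisation.lean`,
  Juhász (2023), proof of Thm. 2.7, Step 1), and in the case `s' = 0` **the thickening is
  diffeomorphic to the `4`-ball** (`nonempty_diffeomorph_closedBall`: classification of
  orientable `4`-dimensional `1`-handlebodies,
  `nonempty_diffeomorph_of_hasHandleDecomposition_handleCount_one_of_oneHandle` with
  `oneHandle_nonempty_diffeomorph_holds`, against
  `hasHandleDecomposition_closedBall 3`; Kosinski (1993), VI (11.4)).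

Everything is **proved**; no named fact is introduced.

## References
* J. Milnor, *Morse theory*, Ann. of Math. Studies 51 (1963), §§2–3. [Milnor1963]
* A. Juhász, *Differential and Low-Dimensional Topology* (2023), proof of Thm. 2.7, Step 1;
  §3.5; §6.1. [Juhasz2023]
* A. A. Kosinski, *Differential Manifolds* (1993), VI (11.4). [Kosinski1993]
-/

open scoped Manifold ContDiff Topology InnerProductSpace
open Set Function Filter Metric Module

noncomputable section

namespace Literature.Topology.FourManifolds

/-- Local notation: `𝔼 n` is the model Euclidean space `EuclideanSpace ℝ (Fin n)`. -/
local notation "𝔼 " n:arg => EuclideanSpace ℝ (Fin n)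

open PlanarThickening SolidThickening

/-! ### §1 Planar Morse functions with `m` minima and `s` saddles below a level -/

/-- **A planar Morse function presenting a domain with `m` `0`-handles and `s` `1`-handles below
the level `c`**: `q : ℝ² → ℝ` is Morse and coercive, has finitely many critical points, no
critical value equal to `c`, exactly `m` critical points of index `0` and `s` of index `1` below
`c`, and all its critical points of index `2` above `c` (so that `{q ≤ c}` is a compact planar
domain built from `m` discs and `s` bands).  The case `m = 1` is
`Literature.Topology.FourManifolds.IsHoledDiscMorseFunction` (Juhász (2023), §3.5).
[cite: Juhasz2023, §3.5, pp. 96–97] -/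
structure IsPlanarCoreMorseFunction (m s : ℕ) (q : 𝔼 2 → ℝ) (c : ℝ) : Prop where
  /-- `q` is a Morse function on the plane. -/
  isMorse : IsMorse (𝓡 2) q
  /-- `q` is coercive: `‖u‖² ≤ q u + B`. -/
  exists_bound : ∃ B : ℝ, ∀ u, ‖u‖ ^ 2 ≤ q u + B
  /-- `q` has finitely many critical points. -/
  finite_criticalSet : (criticalSet (𝓡 2) q).Finite
  /-- No critical value equals `c`. -/
  apply_ne : ∀ u, IsMCriticalPt (𝓡 2) q u → q u ≠ c
  /-- Exactly `m` critical points of index `0` below `c`. -/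
  ncard_index_zero : (criticalSetOfIndex (𝓡 2) q 0 ∩ q ⁻¹' Iic c).ncard = m
  /-- Exactly `s` critical points of index `1` below `c`. -/
  ncard_index_one : (criticalSetOfIndex (𝓡 2) q 1 ∩ q ⁻¹' Iic c).ncard = s
  /-- The maxima lie above `c`. -/
  lt_of_index_two : ∀ u ∈ criticalSetOfIndex (𝓡 2) q 2, c < q u

/-- The one-minimum case: an `IsHoledDiscMorseFunction g q c` is an
`IsPlanarCoreMorseFunction 1 g q c`. [cite: Juhasz2023, §3.5, pp. 96–97] -/
theorem IsHoledDiscMorseFunction.isPlanarCoreMorseFunction {g : ℕ} {q : 𝔼 2 → ℝ} {c : ℝ}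
    (h : IsHoledDiscMorseFunction g q c) : IsPlanarCoreMorseFunction 1 g q c where
  isMorse := h.isMorse
  exists_bound := h.exists_bound
  finite_criticalSet := h.finite_criticalSet
  apply_ne := fun _ hu => h.apply_ne_of_isMCriticalPt hu
  ncard_index_zero := by
    obtain ⟨u₀, h0, hc⟩ := h.exists_index_zero
    have e : ({u₀} : Set (𝔼 2)) ∩ q ⁻¹' Iic c = {u₀} :=
      inter_eq_left.2 (singleton_subset_iff.2 (mem_preimage.2 (mem_Iic.2 hc.le)))
    rw [h0, e, ncard_singleton]
  ncard_index_one := by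
    have e : criticalSetOfIndex (𝓡 2) q 1 ∩ q ⁻¹' Iic c = criticalSetOfIndex (𝓡 2) q 1 :=
      inter_eq_left.2 fun u hu => mem_preimage.2 (mem_Iic.2 (h.lt_of_index_one u hu).le)
    rw [e, h.ncard_index_one]
  lt_of_index_two := h.lt_of_index_two

namespace IsPlanarCoreMorseFunction

variable {m s : ℕ} {q : 𝔼 2 → ℝ} {c : ℝ} (h : IsPlanarCoreMorseFunction m s q c)
include h

/-! ### §2 The thickening `{q + z² + w² ≤ c}` -/

/-- The count below `c` in the plane: `m`, `s`, and nothing else. [cite: Milnor1963, §2] -/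
theorem ncard_criticalSetOfIndex_inter (i : ℕ) :
    (criticalSetOfIndex (𝓡 2) q i ∩ q ⁻¹' Iic c).ncard = handleCount m s i := by
  rcases Nat.lt_or_ge i 3 with hi | hi
  · interval_cases i
    · rw [handleCount_zero, h.ncard_index_zero]
    · rw [handleCount_one, h.ncard_index_one]
    · rw [handleCount_of_two_le _ _ le_rfl]
      have : criticalSetOfIndex (𝓡 2) q 2 ∩ q ⁻¹' Iic c = ∅ :=
        eq_empty_of_forall_notMem fun u ⟨hu, hc⟩ => absurd (mem_Iic.1 hc) (not_le.2 (h.lt_of_index_two u hu))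
      rw [this, ncard_empty]
  · rw [handleCount_of_two_le _ _ (by omega), IsHoledDiscMorseFunction.criticalSetOfIndex_eq_empty hi,
      empty_inter, ncard_empty]

/-- `G = q + z² + w²` is a Morse function on `ℝ⁴`. [folklore] -/
private theorem pc_isMorse₄ : IsMorse (𝓡 4) (thicken₄ (thicken q)) :=
  isMorse_thicken₄ (isMorse_thicken h.isMorse)

/-- The critical points of `G` are the `(x, y, 0, 0)` with `(x, y)` critical for `q`. [folklore] -/
private theorem pc_crit_iff (p : 𝔼 4) :
    IsMCriticalPt (𝓡 4) (thicken₄ (thicken q)) p ↔ ∃ u, IsMCriticalPt (𝓡 2) q u ∧ p = lift₃ (lift u) := by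
  have hq : Differentiable ℝ q := (contDiff_of_isMorse h.isMorse).differentiable (by simp)
  have hF : Differentiable ℝ (thicken q) :=
    (contDiff_thicken (contDiff_of_isMorse h.isMorse)).differentiable (by simp)
  rw [isMCriticalPt_thicken₄_iff' hF]
  constructor
  · rintro ⟨v, hv, rfl⟩
    obtain ⟨u, hu, rfl⟩ := (isMCriticalPt_thicken_iff' hq v).1 hv
    exact ⟨u, hu, rfl⟩
  · rintro ⟨u, hu, rfl⟩
    exact ⟨lift u, (isMCriticalPt_thicken_iff' hq (lift u)).2 ⟨u, hu, rfl⟩, rfl⟩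

/-- **`c` is a regular level of `G`.** [folklore] -/
private theorem pc_regular : IsRegularLevel (𝓡 4) (thicken₄ (thicken q)) c := by
  refine (pc_isMorse₄ h).isRegularLevel fun p hp => ?_
  obtain ⟨u, hu, rfl⟩ := (pc_crit_iff h p).1 hp
  rw [thicken₄_lift₃, thicken_lift]
  exact h.apply_ne u hu

/-- **The thickening** `{q(x, y) + z² + w² ≤ c} ⊂ ℝ⁴` as a regular sublevel set (of
`thicken₄ (thicken q)` at the regular level `c`). [folklore] -/
abbrev FourThickening : Type := RegularSublevel (pc_regular h)

/-- The regularity of the level, in the form consumed downstream: `G = q + z² + w²` is Morse on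
`ℝ⁴` and none of its critical points lies on the level `c`. [folklore] -/
theorem isMorse_and_apply_ne :
    IsMorse (𝓡 4) (thicken₄ (thicken q)) ∧ ∀ p, IsMCriticalPt (𝓡 4) (thicken₄ (thicken q)) p →
      thicken₄ (thicken q) p ≠ c := by
  refine ⟨pc_isMorse₄ h, fun p hp => ?_⟩
  obtain ⟨u, hu, rfl⟩ := (pc_crit_iff h p).1 hp
  rw [thicken₄_lift₃, thicken_lift]
  exact h.apply_ne u hu

/-- A priori bound on `{G ≤ c}`. [folklore] -/
private theorem pc_bound :
    ∃ B : ℝ, ∀ p : 𝔼 4, thicken₄ (thicken q) p ≤ c → ‖p‖ ^ 2 ≤ c + B := by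
  obtain ⟨B, hB⟩ := h.exists_bound
  refine ⟨B, fun p hp => ?_⟩
  rw [SolidThickening.norm_sq_eq, PlanarThickening.norm_sq_eq]
  have := hB (proj (proj₃ p))
  rw [thicken₄_apply, thicken_apply] at hp
  linarith

/-- **`{G ≤ c}` is compact.** [folklore] -/
private theorem pc_compact : IsCompact (thicken₄ (thicken q) ⁻¹' Iic c) := by
  obtain ⟨B, hB⟩ := pc_bound h
  have hcont : Continuous (thicken₄ (thicken q)) :=
    (contDiff_thicken₄ (contDiff_thicken (contDiff_of_isMorse h.isMorse))).continuous
  refine Metric.isCompact_of_isClosed_isBounded (isClosed_Iic.preimage hcont) ?_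
  rw [isBounded_iff_forall_norm_le]
  refine ⟨|c + B| + 1, fun p hp => ?_⟩
  have h1 : ‖p‖ ^ 2 ≤ c + B := hB p hp
  nlinarith [norm_nonneg p, abs_nonneg (c + B), le_abs_self (c + B), sq_nonneg (‖p‖ - 1)]

/-- `{G ≤ c}` is compact. [folklore] -/
instance compactSpace_fourThickening : CompactSpace h.FourThickening :=
  RegularSublevel.compactSpace_of_isCompact _ (pc_compact h)

/-- The handle count of `{G ≤ c}`: `m` of index `0`, `s` of index `1`, nothing else below `c`.
[folklore] -/
theorem ncard_criticalSetOfIndex_inter₄ (i : ℕ) :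
    (criticalSetOfIndex (𝓡 4) (thicken₄ (thicken q)) i ∩ thicken₄ (thicken q) ⁻¹' Iic c).ncard =
      handleCount m s i := by
  have hs : ContDiff ℝ 2 (thicken q) :=
    (contDiff_thicken (contDiff_of_isMorse h.isMorse)).of_le (by norm_cast)
  have hq : ContDiff ℝ 2 q := (contDiff_of_isMorse h.isMorse).of_le (by norm_cast)
  rw [criticalSetOfIndex_thicken₄_inter hs, ncard_image_of_injective _ lift₃_injective,
    criticalSetOfIndex_thicken_inter hq, ncard_image_of_injective _ lift_injective,
    h.ncard_criticalSetOfIndex_inter i]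

/-- `{G ≤ c}` is orientable (codimension `0` in `ℝ⁴`). [folklore] -/
private theorem pc_orientable : IsOrientable (𝓡∂ 4) h.FourThickening :=
  RegularSublevel.isOrientable _ (isOrientable_euclideanSpace 4)

/-- **`{G ≤ c}` has a handle decomposition with `m` `0`-handles and `s` `1`-handles.**
[cite: Milnor1963, Thms. 3.1–3.2] -/
theorem hasHandleDecomposition_fourThickening :
    HasHandleDecomposition 3 h.FourThickening (handleCount m s) := by
  have hd := RegularSublevel.hasHandleDecomposition (pc_isMorse₄ h) (pc_regular h)
  have hfun : (fun i => (criticalSetOfIndex (𝓡 4) (thicken₄ (thicken q)) i ∩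
      thicken₄ (thicken q) ⁻¹' Iic c).ncard) = handleCount m s :=
    funext h.ncard_criticalSetOfIndex_inter₄
  rw [hfun] at hd
  exact hd

/-! ### §3 Connected thickenings: normalised counts and the ball case -/

/-- **On a connected thickening the counts normalise**: `m = r + 1` minima and `s = s' + r`
saddles below `c` give a handle decomposition with one `0`-handle and `s'` `1`-handles
(`hasHandleDecomposition_handleCount_one_of_counts`). [cite: Juhasz2023, proof of Thm. 2.7, Step 1] -/
theorem hasHandleDecomposition_handleCount_one [ConnectedSpace h.FourThickening] {r s' : ℕ}
    (hm : m = r + 1) (hs : s = s' + r) : HasHandleDecomposition 3 h.FourThickening (handleCount 1 s') :=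
  hasHandleDecomposition_handleCount_one_of_counts (r := r) h.hasHandleDecomposition_fourThickening
    (by rw [handleCount_zero, hm]) (by rw [handleCount_one, hs]) fun k hk => handleCount_of_two_le _ _ hk

/-- **The ball case.**  A connected thickening with `r + 1` minima and `r` saddles below `c` is
diffeomorphic, as a manifold with boundary, to the closed `4`-ball (classification of orientable
`4`-dimensional `1`-handlebodies of type `(1, 0)` against `𝔻⁴`,
`hasHandleDecomposition_closedBall 3`). [cite: Kosinski1993, VI (11.4)(c)] -/
theorem nonempty_diffeomorph_closedBall [ConnectedSpace h.FourThickening] {r : ℕ}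
    (hm : m = r + 1) (hs : s = r) :
    Nonempty (h.FourThickening ≃ₘ⟮𝓡∂ 4, 𝓡∂ 4⟯ Metric.closedBall (0 : 𝔼 4) 1) := by
  haveI : Fact (isSmoothEmbedding_sphereInclusion' 3) := ⟨isSmoothEmbedding_sphereInclusion'_holds 3⟩
  haveI : ConnectedSpace (Metric.closedBall (0 : 𝔼 4) 1) := connectedSpace_closedBall 3
  haveI : CompactSpace (Metric.closedBall (0 : 𝔼 4) 1) :=
    isCompact_iff_compactSpace.1 (isCompact_closedBall _ _)
  exact nonempty_diffeomorph_of_hasHandleDecomposition_handleCount_one_of_oneHandle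
    oneHandle_nonempty_diffeomorph_holds 0 h.FourThickening
    (Metric.closedBall (0 : 𝔼 4) 1) (h.hasHandleDecomposition_handleCount_one hm (by simpa using hs))
    (pc_orientable h) (hasHandleDecomposition_closedBall 3) (isOrientable_closedBall 3)

end IsPlanarCoreMorseFunction

end Literature.Topology.FourManifolds
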